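import Summits.Ventures.Crystal3D.Theorems.StickyWulffConstantGenericWallFloorTwinTree
import Summits.Ventures.Crystal3D.Theorems.StickyWulffConstantGenericWallFloorChainTerminalClass
import HarnessLib

/-!
# The admissible frames of a walk and the UNIQUE terminal twin family of a chain pair

HONEST FRAMING. Venture `Summits/Ventures/Crystal3D` (cell `crystal3d-full`), helper for the crux
`GenericWallFloor` (stmt-Ventures-19480) of `route-Ventures-StickyWulffConstant`, REGISTERED line `WallLedgerG`,
open stub `stub_twoSlabAdhesion` (general fillings; the `Σ3ⁿ` chain pairs).  Rung credit only; F-C1 not moved.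

`exists_admissible_frames`: fix the two grain frames `A₁, A₂` and the TERMINAL CLASS
`𝓣₀ = {G : G(Λ₀) = A₂(Λ₀), or e₃ is a menu normal of A₂ and G(Λ₀) is the horizontal mirror image of A₂(Λ₀)}`
with `A₁ ∉ 𝓣₀` (this is non-co-axiality, …ChainTerminalClass).  There are a set `𝓐 ∋ A₁` of frames, disjoint
from `𝓣₀`, and ONE unit vector `n⋆` with `⟪n⋆, e₃⟫² < 1` such that every `{111}` mirror of a frame of `𝓐`
either stays in `𝓐` or lands in `𝓣₀`, and in the latter case its normal is `± n⋆`.  So along ANY coherent walk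
started on the bottom grain, every mirror into the terminal class is across ONE plane family `n⋆` — the walk of
the next files refuses exactly these mirrors and slides up the plate instead, which makes the chain-pair charge
`h`-free.  Mechanism: `𝓐` = frames `A₁ ∘ wordMap P` for reduced words `P` none of whose suffixes is terminal;
a menu normal of such a frame is `± (A₁ ∘ wordMap P)(ν_c)` (`menu_cubic_coords_pm_one`), the mirror is the
frame of `c :: P`; by the tree property (`eq_of_isChain_of_image_eq`) a terminal reduced word is the shortest
terminal word `T₀` or its horizontal neighbour `c_h :: T₀`, and the latter is never reached first.
WHAT THIS IS NOT: no packing statement; F-C1 not moved.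
-/

noncomputable section

namespace Summit.Ventures.Crystal3D.Theorems

open Summit.Ventures.Crystal3D Finset Matrix NearIdentity
open Literature.MathematicalPhysics.StatisticalMechanics (fccStacking)
open scoped InnerProductSpace

/-- Every `±1` cubic triple is `±` a class representative. -/
theorem exists_diagInt_eq (k : Fin 3 → ℤ) (hk : ∀ j, k j = 1 ∨ k j = -1) :
    ∃ c : Fin 4, ∃ s : ℤ, (s = 1 ∨ s = -1) ∧ ∀ j, k j = s * diagInt c j := by
  have h0 := hk 0; have h1 := hk 1; have h2 := hk 2
  have key : ∀ c : Fin 4, ∀ s : ℤ, (s = 1 ∨ s = -1) → k 0 = s * diagInt c 0 → k 1 = s * diagInt c 1 →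
      k 2 = s * diagInt c 2 → ∃ c : Fin 4, ∃ s : ℤ, (s = 1 ∨ s = -1) ∧ ∀ j, k j = s * diagInt c j := by
    intro c s hs e0 e1 e2
    refine ⟨c, s, hs, fun j => ?_⟩
    fin_cases j
    · exact e0
    · exact e1
    · exact e2
  rcases h0 with h0 | h0 <;> rcases h1 with h1 | h1 <;> rcases h2 with h2 | h2
  · exact key 0 1 (Or.inl rfl) (by rw [h0]; decide) (by rw [h1]; decide) (by rw [h2]; decide)
  · exact key 1 1 (Or.inl rfl) (by rw [h0]; decide) (by rw [h1]; decide) (by rw [h2]; decide)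
  · exact key 2 1 (Or.inl rfl) (by rw [h0]; decide) (by rw [h1]; decide) (by rw [h2]; decide)
  · exact key 3 1 (Or.inl rfl) (by rw [h0]; decide) (by rw [h1]; decide) (by rw [h2]; decide)
  · exact key 3 (-1) (Or.inr rfl) (by rw [h0]; decide) (by rw [h1]; decide) (by rw [h2]; decide)
  · exact key 2 (-1) (Or.inr rfl) (by rw [h0]; decide) (by rw [h1]; decide) (by rw [h2]; decide)
  · exact key 1 (-1) (Or.inr rfl) (by rw [h0]; decide) (by rw [h1]; decide) (by rw [h2]; decide)
  · exact key 0 (-1) (Or.inr rfl) (by rw [h0]; decide) (by rw [h1]; decide) (by rw [h2]; decide)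

/-- The inner products of slots with a class representative lie in the menu `{0, ±√(2/3)}`. -/
theorem slot_inner_diagVec_menu (c : Fin 4) : ∀ w ∈ fccSlots,
    ⟪w, diagVec c⟫_ℝ = 0 ∨ ⟪w, diagVec c⟫_ℝ = Real.sqrt (2 / 3) ∨ ⟪w, diagVec c⟫_ℝ = -Real.sqrt (2 / 3) := by
  intro w hw
  obtain ⟨k, rfl⟩ := exists_slotSite_eq hw
  have h23 : Real.sqrt (2 / 3) = 2 / (Real.sqrt 2 * Real.sqrt 3) := by
    rw [Real.sqrt_div (by norm_num : (0 : ℝ) ≤ 2), div_eq_div_iff (by positivity) (by positivity), ← mul_assoc,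
      Real.mul_self_sqrt (by norm_num : (0 : ℝ) ≤ 2)]
  have hval : ⟪slotSite k, diagVec c⟫_ℝ = ((∑ i : Fin 3, slotInt k i * diagInt c i : ℤ) : ℝ) / (Real.sqrt 2 * Real.sqrt 3) := by
    rw [inner_diagVec]
    simp only [cubicCoords_slotSite, slotVec, Fin.sum_univ_three]
    push_cast
    have hs2 : Real.sqrt 2 ≠ 0 := by positivity
    have hs3 : Real.sqrt 3 ≠ 0 := by positivity
    field_simp
  have hint : (∑ i : Fin 3, slotInt k i * diagInt c i : ℤ) = 0 ∨ (∑ i : Fin 3, slotInt k i * diagInt c i : ℤ) = 2 ∨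
      (∑ i : Fin 3, slotInt k i * diagInt c i : ℤ) = -2 := by
    fin_cases k <;> fin_cases c <;> decide
  rw [hval, h23]
  rcases hint with h | h | h <;> rw [h] <;> push_cast
  · left; simp
  · right; left; rfl
  · right; right; ring

/-- **The admissible frames and the unique terminal family.**  See the module docstring. -/
theorem exists_admissible_frames
    (A₁ A₂ : EuclideanSpace ℝ (Fin 3) ≃ₗᵢ[ℝ] EuclideanSpace ℝ (Fin 3))
    (hA₁ : A₁ ∉ {G : EuclideanSpace ℝ (Fin 3) ≃ₗᵢ[ℝ] EuclideanSpace ℝ (Fin 3) |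
      G '' fccStacking 1 (Real.sqrt (2 / 3)) = A₂ '' fccStacking 1 (Real.sqrt (2 / 3)) ∨
      ((∀ w ∈ fccSlots, ⟪A₂ w, EuclideanSpace.single (2 : Fin 3) (1 : ℝ)⟫_ℝ = 0 ∨
          ⟪A₂ w, EuclideanSpace.single (2 : Fin 3) (1 : ℝ)⟫_ℝ = Real.sqrt (2 / 3) ∨
          ⟪A₂ w, EuclideanSpace.single (2 : Fin 3) (1 : ℝ)⟫_ℝ = -Real.sqrt (2 / 3)) ∧
        G '' fccStacking 1 (Real.sqrt (2 / 3)) =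
          (fun x => x - (2 * ⟪x, EuclideanSpace.single (2 : Fin 3) (1 : ℝ)⟫_ℝ) • EuclideanSpace.single (2 : Fin 3) (1 : ℝ)) ''
            (A₂ '' fccStacking 1 (Real.sqrt (2 / 3))))}) :
    ∃ (𝓐 : Set (EuclideanSpace ℝ (Fin 3) ≃ₗᵢ[ℝ] EuclideanSpace ℝ (Fin 3))) (nstar : EuclideanSpace ℝ (Fin 3)),
      ‖nstar‖ = 1 ∧ ⟪nstar, EuclideanSpace.single (2 : Fin 3) (1 : ℝ)⟫_ℝ ^ 2 < 1 ∧ A₁ ∈ 𝓐 ∧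
      (∀ F ∈ 𝓐, F ∉ {G : EuclideanSpace ℝ (Fin 3) ≃ₗᵢ[ℝ] EuclideanSpace ℝ (Fin 3) |
        G '' fccStacking 1 (Real.sqrt (2 / 3)) = A₂ '' fccStacking 1 (Real.sqrt (2 / 3)) ∨
        ((∀ w ∈ fccSlots, ⟪A₂ w, EuclideanSpace.single (2 : Fin 3) (1 : ℝ)⟫_ℝ = 0 ∨
            ⟪A₂ w, EuclideanSpace.single (2 : Fin 3) (1 : ℝ)⟫_ℝ = Real.sqrt (2 / 3) ∨
            ⟪A₂ w, EuclideanSpace.single (2 : Fin 3) (1 : ℝ)⟫_ℝ = -Real.sqrt (2 / 3)) ∧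
          G '' fccStacking 1 (Real.sqrt (2 / 3)) =
            (fun x => x - (2 * ⟪x, EuclideanSpace.single (2 : Fin 3) (1 : ℝ)⟫_ℝ) • EuclideanSpace.single (2 : Fin 3) (1 : ℝ)) ''
              (A₂ '' fccStacking 1 (Real.sqrt (2 / 3))))}) ∧
      ∀ F ∈ 𝓐, ∀ n : EuclideanSpace ℝ (Fin 3), ‖n‖ = 1 →
        (∀ w ∈ fccSlots, ⟪F w, n⟫_ℝ = 0 ∨ ⟪F w, n⟫_ℝ = Real.sqrt (2 / 3) ∨ ⟪F w, n⟫_ℝ = -Real.sqrt (2 / 3)) →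
        ∀ F' : EuclideanSpace ℝ (Fin 3) ≃ₗᵢ[ℝ] EuclideanSpace ℝ (Fin 3), (∀ x, F' x = F x - (2 * ⟪F x, n⟫_ℝ) • n) →
          (F' ∉ {G : EuclideanSpace ℝ (Fin 3) ≃ₗᵢ[ℝ] EuclideanSpace ℝ (Fin 3) |
              G '' fccStacking 1 (Real.sqrt (2 / 3)) = A₂ '' fccStacking 1 (Real.sqrt (2 / 3)) ∨
              ((∀ w ∈ fccSlots, ⟪A₂ w, EuclideanSpace.single (2 : Fin 3) (1 : ℝ)⟫_ℝ = 0 ∨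
                  ⟪A₂ w, EuclideanSpace.single (2 : Fin 3) (1 : ℝ)⟫_ℝ = Real.sqrt (2 / 3) ∨
                  ⟪A₂ w, EuclideanSpace.single (2 : Fin 3) (1 : ℝ)⟫_ℝ = -Real.sqrt (2 / 3)) ∧
                G '' fccStacking 1 (Real.sqrt (2 / 3)) =
                  (fun x => x - (2 * ⟪x, EuclideanSpace.single (2 : Fin 3) (1 : ℝ)⟫_ℝ) • EuclideanSpace.single (2 : Fin 3) (1 : ℝ)) ''
                    (A₂ '' fccStacking 1 (Real.sqrt (2 / 3))))} → F' ∈ 𝓐) ∧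
          (F' ∈ {G : EuclideanSpace ℝ (Fin 3) ≃ₗᵢ[ℝ] EuclideanSpace ℝ (Fin 3) |
              G '' fccStacking 1 (Real.sqrt (2 / 3)) = A₂ '' fccStacking 1 (Real.sqrt (2 / 3)) ∨
              ((∀ w ∈ fccSlots, ⟪A₂ w, EuclideanSpace.single (2 : Fin 3) (1 : ℝ)⟫_ℝ = 0 ∨
                  ⟪A₂ w, EuclideanSpace.single (2 : Fin 3) (1 : ℝ)⟫_ℝ = Real.sqrt (2 / 3) ∨
                  ⟪A₂ w, EuclideanSpace.single (2 : Fin 3) (1 : ℝ)⟫_ℝ = -Real.sqrt (2 / 3)) ∧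
                G '' fccStacking 1 (Real.sqrt (2 / 3)) =
                  (fun x => x - (2 * ⟪x, EuclideanSpace.single (2 : Fin 3) (1 : ℝ)⟫_ℝ) • EuclideanSpace.single (2 : Fin 3) (1 : ℝ)) ''
                    (A₂ '' fccStacking 1 (Real.sqrt (2 / 3))))} → n = nstar ∨ n = -nstar) := by
  set e₃ : EuclideanSpace ℝ (Fin 3) := EuclideanSpace.single (2 : Fin 3) (1 : ℝ) with he₃
  set Λ₀ : Set (EuclideanSpace ℝ (Fin 3)) := fccStacking 1 (Real.sqrt (2 / 3)) with hΛ₀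
  set H : EuclideanSpace ℝ (Fin 3) → EuclideanSpace ℝ (Fin 3) := fun x => x - (2 * ⟪x, e₃⟫_ℝ) • e₃ with hH
  set menu₂ : Prop := ∀ w ∈ fccSlots, ⟪A₂ w, e₃⟫_ℝ = 0 ∨ ⟪A₂ w, e₃⟫_ℝ = Real.sqrt (2 / 3) ∨
    ⟪A₂ w, e₃⟫_ℝ = -Real.sqrt (2 / 3) with hmenu₂
  set 𝓣 : Set (EuclideanSpace ℝ (Fin 3) ≃ₗᵢ[ℝ] EuclideanSpace ℝ (Fin 3)) :=
    {G | G '' Λ₀ = A₂ '' Λ₀ ∨ (menu₂ ∧ G '' Λ₀ = H '' (A₂ '' Λ₀))} with h𝓣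
  have he₃n : ‖e₃‖ = 1 := by rw [he₃, PiLp.norm_single, norm_one]
  have hHH : ∀ y, H (H y) = y := fun y => by simp only [hH, he₃]; exact horizMirror_horizMirror y
  have hHe : ∀ y, ⟪H y, e₃⟫_ℝ = -⟪y, e₃⟫_ℝ := fun y => by simp only [hH, he₃]; exact inner_horizMirror_e₃ y
  -- frames of words
  set Fr : List (Fin 4) → (EuclideanSpace ℝ (Fin 3) ≃ₗᵢ[ℝ] EuclideanSpace ℝ (Fin 3)) :=
    fun P => (wordMap P).trans A₁ with hFr
  have hFr_apply : ∀ P x, Fr P x = A₁ (wordMap P x) := fun P x => rfl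
  have hFr_nil : Fr [] = A₁ := LinearIsometryEquiv.ext fun x => rfl
  have hFr_cc : ∀ c P, Fr (c :: c :: P) = Fr P := fun c P =>
    LinearIsometryEquiv.ext fun x => by rw [hFr_apply, hFr_apply, wordMap_cons_cons_apply]
  have hFr_img : ∀ P, Fr P '' Λ₀ = A₁ '' (wordMap P '' Λ₀) := fun P => by
    rw [Set.image_image]; rfl
  -- the reduced step
  have step_eq : ∀ (c : Fin 4) (P : List (Fin 4)), ∃ P' : List (Fin 4),
      (P.IsChain (· ≠ ·) → P'.IsChain (· ≠ ·)) ∧ Fr P' = Fr (c :: P) ∧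
      (P' = c :: P ∧ (∀ y ∈ P.head?, c ≠ y) ∨ P = c :: P') := by
    intro c P
    by_cases hh : ∀ y ∈ P.head?, c ≠ y
    · exact ⟨c :: P, fun hP => List.isChain_cons.2 ⟨hh, hP⟩, rfl, Or.inl ⟨rfl, hh⟩⟩
    · push Not at hh
      obtain ⟨y, hy, rfl⟩ := hh
      obtain ⟨Q, rfl⟩ : ∃ Q, P = c :: Q := by
        cases P with
        | nil => simp at hy
        | cons d Q => simp only [List.head?_cons, Option.mem_def, Option.some.injEq] at hy; exact ⟨Q, by rw [hy]⟩
      exact ⟨Q, fun hP => hP.tail, (hFr_cc c Q).symm, Or.inr rfl⟩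
  -- a menu normal of a frame of a word is `±` the image of a class representative, and the mirror is the next frame
  have mirror : ∀ (P : List (Fin 4)) (n : EuclideanSpace ℝ (Fin 3)), ‖n‖ = 1 →
      (∀ w ∈ fccSlots, ⟪Fr P w, n⟫_ℝ = 0 ∨ ⟪Fr P w, n⟫_ℝ = Real.sqrt (2 / 3) ∨ ⟪Fr P w, n⟫_ℝ = -Real.sqrt (2 / 3)) →
      ∃ c : Fin 4, (n = Fr P (diagVec c) ∨ n = -Fr P (diagVec c)) ∧
        ∀ F' : EuclideanSpace ℝ (Fin 3) ≃ₗᵢ[ℝ] EuclideanSpace ℝ (Fin 3), (∀ x, F' x = Fr P x - (2 * ⟪Fr P x, n⟫_ℝ) • n) →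
          F' = Fr (c :: P) := by
    intro P n hn hmenu
    obtain ⟨k, hk, hkj⟩ := menu_cubic_coords_pm_one (Fr P) hn hmenu
    obtain ⟨c, s, hs, hks⟩ := exists_diagInt_eq k hk
    have h3 : Real.sqrt 3 ≠ 0 := by positivity
    -- `(Fr P)⁻¹ n = s • diagVec c`
    have hν : (Fr P).symm n = (s : ℝ) • diagVec c := by
      apply cubicCoords_injective
      ext j
      rw [cubicCoords_smul, Pi.smul_apply, smul_eq_mul, cubicCoords_diagVec, ← inner_cubicFrame]
      have e1 : ⟪(Fr P).symm n, cubicFrame j⟫_ℝ = ⟪Fr P (cubicFrame j), n⟫_ℝ := by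
        rw [← (Fr P).inner_map_map, LinearIsometryEquiv.apply_symm_apply, real_inner_comm]
      rw [e1]
      have := hkj j
      rw [hks j] at this
      push_cast at this
      field_simp
      linarith
    have hn' : n = (s : ℝ) • Fr P (diagVec c) := by
      rw [← LinearIsometryEquiv.map_smul, ← hν, LinearIsometryEquiv.apply_symm_apply]
    have hs2 : (s : ℝ) * s = 1 := by rcases hs with h | h <;> rw [h] <;> norm_num
    refine ⟨c, ?_, fun F' hF' => LinearIsometryEquiv.ext fun x => ?_⟩
    · rcases hs with h | h
      · left; rw [hn', h]; simp
      · right; rw [hn', h]; simp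
    · have e1 : ⟪Fr P x, Fr P (diagVec c)⟫_ℝ = ⟪x, diagVec c⟫_ℝ := (Fr P).inner_map_map _ _
      have e2 : Fr (c :: P) x = Fr P x - (2 * ⟪x, diagVec c⟫_ℝ) • Fr P (diagVec c) := by
        rw [hFr_apply P x, hFr_apply P (diagVec c), hFr_apply, wordMap_cons_apply, twinGen_apply, map_sub, map_smul,
          map_sub, map_smul]
      rw [hF' x, e2, hn', real_inner_smul_right, e1, smul_smul]
      congr 1
      rw [show 2 * ((s : ℝ) * ⟪x, diagVec c⟫_ℝ) * (s : ℝ) = 2 * ⟪x, diagVec c⟫_ℝ * ((s : ℝ) * s) by ring,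
        hs2, mul_one]
  -- the admissible class
  set 𝓐 : Set (EuclideanSpace ℝ (Fin 3) ≃ₗᵢ[ℝ] EuclideanSpace ℝ (Fin 3)) :=
    {F | ∃ P : List (Fin 4), P.IsChain (· ≠ ·) ∧ F = Fr P ∧ ∀ S, S <:+ P → Fr S ∉ 𝓣} with h𝓐
  have hA₁𝓐 : A₁ ∈ 𝓐 := ⟨[], List.isChain_nil, hFr_nil.symm, fun S hS => by
    rw [List.suffix_nil.1 hS, hFr_nil]; exact hA₁⟩
  have h𝓐𝓣 : ∀ F ∈ 𝓐, F ∉ 𝓣 := by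
    rintro F ⟨P, -, hF, hsuf⟩; rw [hF]; exact hsuf P (List.suffix_refl P)
  -- one mirror step from a word of `𝓐`
  have stepA : ∀ (P : List (Fin 4)), P.IsChain (· ≠ ·) → (∀ S, S <:+ P → Fr S ∉ 𝓣) →
      ∀ n : EuclideanSpace ℝ (Fin 3), ‖n‖ = 1 →
      (∀ w ∈ fccSlots, ⟪Fr P w, n⟫_ℝ = 0 ∨ ⟪Fr P w, n⟫_ℝ = Real.sqrt (2 / 3) ∨ ⟪Fr P w, n⟫_ℝ = -Real.sqrt (2 / 3)) →
      ∀ F' : EuclideanSpace ℝ (Fin 3) ≃ₗᵢ[ℝ] EuclideanSpace ℝ (Fin 3), (∀ x, F' x = Fr P x - (2 * ⟪Fr P x, n⟫_ℝ) • n) →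
      ∃ c : Fin 4, (n = Fr P (diagVec c) ∨ n = -Fr P (diagVec c)) ∧
        (F' ∉ 𝓣 → F' ∈ 𝓐) ∧ (F' ∈ 𝓣 → (c :: P).IsChain (· ≠ ·) ∧ F' = Fr (c :: P)) := by
    intro P hP hsuf n hn hmenu F' hF'
    obtain ⟨c, hnc, hF'eq⟩ := mirror P n hn hmenu
    have hF'c := hF'eq F' hF'
    obtain ⟨P', hP'red, hP'Fr, halt⟩ := step_eq c P
    refine ⟨c, hnc, fun hnot => ⟨P', hP'red hP, by rw [hF'c, hP'Fr], fun S hS => ?_⟩, fun hmem => ?_⟩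
    · rcases halt with ⟨rfl, -⟩ | hP
      · rcases List.suffix_cons_iff.1 hS with rfl | hS'
        · rw [← hF'c]; exact hnot
        · exact hsuf S hS'
      · exact hsuf S (hS.trans (by rw [hP]; exact List.suffix_cons _ _))
    · rcases halt with ⟨rfl, hh⟩ | hP
      · exact ⟨List.isChain_cons.2 ⟨hh, hP⟩, hF'c⟩
      · exfalso
        have : Fr P' ∉ 𝓣 := hsuf P' (by rw [hP]; exact List.suffix_cons _ _)
        rw [hP'Fr, ← hF'c] at this
        exact this hmem
  -- ENTERED TERMINAL WORDS `c :: P` (reduced, terminal, no terminal suffix of `P`) are all equal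
  have typeAB : ∀ W : List (Fin 4), Fr W ∈ 𝓣 →
      Fr W '' Λ₀ = A₂ '' Λ₀ ∨ (menu₂ ∧ Fr W '' Λ₀ = H '' (A₂ '' Λ₀)) := fun W h => h
  -- equal image type ⇒ equal words
  have inj_img : ∀ W W' : List (Fin 4), Fr W '' Λ₀ = Fr W' '' Λ₀ → wordMap W '' Λ₀ = wordMap W' '' Λ₀ := by
    intro W W' h
    rw [hFr_img, hFr_img] at h
    exact (Set.image_injective.2 A₁.injective) h
  -- the horizontal step of a word
  have hstep : ∀ W : List (Fin 4),
      (∀ w ∈ fccSlots, ⟪Fr W w, e₃⟫_ℝ = 0 ∨ ⟪Fr W w, e₃⟫_ℝ = Real.sqrt (2 / 3) ∨ ⟪Fr W w, e₃⟫_ℝ = -Real.sqrt (2 / 3)) →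
      ∃ c : Fin 4, ∀ x, Fr (c :: W) x = H (Fr W x) := by
    intro W hmenu
    obtain ⟨c, -, hF'eq⟩ := mirror W e₃ he₃n hmenu
    refine ⟨c, fun x => ?_⟩
    have key := hF'eq ((Fr W).trans (ℝ ∙ e₃)ᗮ.reflection) (fun x => by
      rw [LinearIsometryEquiv.trans_apply, bondReflection_apply _ _ he₃n, real_inner_comm])
    rw [← key, LinearIsometryEquiv.trans_apply, bondReflection_apply _ _ he₃n, real_inner_comm]
  have hHimg : ∀ S : Set (EuclideanSpace ℝ (Fin 3)), H '' (H '' S) = S := by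
    intro S; rw [Set.image_image]; conv_rhs => rw [← Set.image_id S]
    exact Set.image_congr fun x _ => hHH x
  -- menu of `e₃` transfers to type-A and type-B words
  have menuA : ∀ W : List (Fin 4), Fr W '' Λ₀ = A₂ '' Λ₀ → menu₂ →
      ∀ w ∈ fccSlots, ⟪Fr W w, e₃⟫_ℝ = 0 ∨ ⟪Fr W w, e₃⟫_ℝ = Real.sqrt (2 / 3) ∨ ⟪Fr W w, e₃⟫_ℝ = -Real.sqrt (2 / 3) :=
    fun W h hm => menu_of_image_eq A₂ (Fr W) h.symm hm
  have menuB : ∀ W : List (Fin 4), Fr W '' Λ₀ = H '' (A₂ '' Λ₀) → menu₂ →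
      ∀ w ∈ fccSlots, ⟪Fr W w, e₃⟫_ℝ = 0 ∨ ⟪Fr W w, e₃⟫_ℝ = Real.sqrt (2 / 3) ∨ ⟪Fr W w, e₃⟫_ℝ = -Real.sqrt (2 / 3) := by
    intro W h hm
    have hG : (A₂.trans (ℝ ∙ e₃)ᗮ.reflection) '' Λ₀ = H '' (A₂ '' Λ₀) := by
      rw [Set.image_image]
      exact Set.image_congr fun x _ => by
        rw [LinearIsometryEquiv.trans_apply, bondReflection_apply _ _ he₃n, real_inner_comm]
    refine menu_of_image_eq (A₂.trans (ℝ ∙ e₃)ᗮ.reflection) (Fr W) (by rw [hG, h]) ?_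
    intro w hw
    have e1 : ⟪(A₂.trans (ℝ ∙ e₃)ᗮ.reflection) w, e₃⟫_ℝ = -⟪A₂ w, e₃⟫_ℝ := by
      rw [LinearIsometryEquiv.trans_apply, bondReflection_apply _ _ he₃n, real_inner_comm (A₂ w) e₃]
      exact hHe (A₂ w)
    rw [e1]
    rcases hm w hw with h0 | h0 | h0 <;> rw [h0]
    · left; ring
    · right; right; rfl
    · right; left; ring
  -- cross types are contradictory for entered terminal words
  have cross : ∀ (c : Fin 4) (P : List (Fin 4)) (c' : Fin 4) (P' : List (Fin 4)),
      (c :: P).IsChain (· ≠ ·) → (∀ S, S <:+ P → Fr S ∉ 𝓣) →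
      (c' :: P').IsChain (· ≠ ·) → (∀ S, S <:+ P' → Fr S ∉ 𝓣) → Fr (c' :: P') ∈ 𝓣 →
      Fr (c :: P) '' Λ₀ = A₂ '' Λ₀ → (menu₂ ∧ Fr (c' :: P') '' Λ₀ = H '' (A₂ '' Λ₀)) → False := by
    intro c P c' P' hred hsuf hred' hsuf' hterm' hA ⟨hm, hB⟩
    obtain ⟨ch, hch⟩ := hstep (c :: P) (menuA _ hA hm)
    -- the reduced form of `ch :: c :: P` has the lattice of `c' :: P'`
    obtain ⟨W'', hW''red, hW''Fr, halt⟩ := step_eq ch (c :: P)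
    have himg : wordMap W'' '' Λ₀ = wordMap (c' :: P') '' Λ₀ := by
      apply inj_img
      rw [hW''Fr, hB, ← hA, Set.image_image]
      exact Set.image_congr fun x _ => hch x
    have hEq : W'' = c' :: P' := eq_of_isChain_of_image_eq _ _ (hW''red hred) hred' himg
    rcases halt with ⟨hW'', -⟩ | hP
    · -- `c' :: P' = ch :: c :: P`, so `P' = c :: P` is terminal and a suffix of itself
      rw [hW''] at hEq
      have hP' : P' = c :: P := (List.cons.inj hEq).2.symm
      have : Fr P' ∉ 𝓣 := hsuf' P' (List.suffix_refl _)
      rw [hP'] at this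
      exact this (Or.inl hA)
    · -- `c :: P = ch :: W''` with `W'' = c' :: P'`: then `P = c' :: P'` is terminal and a suffix of `P`
      rw [hEq] at hP
      have hP2 : P = c' :: P' := (List.cons.inj hP).2
      have : Fr P ∉ 𝓣 := hsuf P (List.suffix_refl _)
      rw [hP2] at this
      exact this hterm'
  have unique : ∀ (c : Fin 4) (P : List (Fin 4)) (c' : Fin 4) (P' : List (Fin 4)),
      (c :: P).IsChain (· ≠ ·) → (∀ S, S <:+ P → Fr S ∉ 𝓣) → Fr (c :: P) ∈ 𝓣 →
      (c' :: P').IsChain (· ≠ ·) → (∀ S, S <:+ P' → Fr S ∉ 𝓣) → Fr (c' :: P') ∈ 𝓣 → c :: P = c' :: P' := by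
    intro c P c' P' hred hsuf hterm hred' hsuf' hterm'
    rcases typeAB _ hterm with hA | hB <;> rcases typeAB _ hterm' with hA' | hB'
    · exact eq_of_isChain_of_image_eq _ _ hred hred' (inj_img _ _ (hA.trans hA'.symm))
    · exact (cross c P c' P' hred hsuf hred' hsuf' hterm' hA hB').elim
    · exact (cross c' P' c P hred' hsuf' hred hsuf hterm hA' hB).elim
    · exact eq_of_isChain_of_image_eq _ _ hred hred' (inj_img _ _ (hB.2.trans hB'.2.symm))
  -- the menu property of the class representatives in any word frame
  have menuFr : ∀ (P : List (Fin 4)) (c : Fin 4), ∀ w ∈ fccSlots, ⟪Fr P w, Fr P (diagVec c)⟫_ℝ = 0 ∨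
      ⟪Fr P w, Fr P (diagVec c)⟫_ℝ = Real.sqrt (2 / 3) ∨ ⟪Fr P w, Fr P (diagVec c)⟫_ℝ = -Real.sqrt (2 / 3) := by
    intro P c w hw
    rw [LinearIsometryEquiv.inner_map_map]
    exact slot_inner_diagVec_menu c w hw
  -- the terminal normal
  by_cases hex : ∃ (c : Fin 4) (P : List (Fin 4)), (c :: P).IsChain (· ≠ ·) ∧ (∀ S, S <:+ P → Fr S ∉ 𝓣) ∧
      Fr (c :: P) ∈ 𝓣
  · obtain ⟨c₀, P₀, hred₀, hsuf₀, hterm₀⟩ := hex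
    have hP₀ : Fr P₀ ∉ 𝓣 := hsuf₀ P₀ (List.suffix_refl _)
    have hunit : ‖Fr P₀ (diagVec c₀)‖ = 1 := by rw [LinearIsometryEquiv.norm_map, norm_diagVec]
    have hformula : ∀ x, Fr (c₀ :: P₀) x = Fr P₀ x - (2 * ⟪Fr P₀ x, Fr P₀ (diagVec c₀)⟫_ℝ) • Fr P₀ (diagVec c₀) := by
      intro x
      rw [LinearIsometryEquiv.inner_map_map, hFr_apply P₀ x, hFr_apply P₀ (diagVec c₀), hFr_apply,
        wordMap_cons_apply, twinGen_apply, map_sub, map_smul, map_sub, map_smul]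
    refine ⟨𝓐, Fr P₀ (diagVec c₀), hunit, ?_, hA₁𝓐, h𝓐𝓣, ?_⟩
    · -- tilt: a horizontal terminal mirror would put `Fr P₀` in the terminal class
      have hle : ⟪Fr P₀ (diagVec c₀), e₃⟫_ℝ ^ 2 ≤ 1 := by
        have h1 := abs_real_inner_le_norm (Fr P₀ (diagVec c₀)) e₃
        rw [hunit, he₃n, one_mul] at h1
        have h2 := abs_le.1 h1
        nlinarith
      rcases lt_or_eq_of_le hle with hlt | heq
      · exact hlt
      · exfalso
        set t : ℝ := ⟪Fr P₀ (diagVec c₀), e₃⟫_ℝ with ht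
        have hnt : Fr P₀ (diagVec c₀) = t • e₃ := by
          have h0 : ‖Fr P₀ (diagVec c₀) - t • e₃‖ ^ 2 = 0 := by
            rw [norm_sub_sq_real, hunit, norm_smul, he₃n, mul_one, real_inner_smul_right, ← ht, Real.norm_eq_abs,
              sq_abs, one_pow]
            nlinarith
          exact sub_eq_zero.1 (norm_eq_zero.1 (pow_eq_zero_iff two_ne_zero |>.1 h0))
        have htt : t * t = 1 := by nlinarith
        have hH' : ∀ x, Fr (c₀ :: P₀) x = H (Fr P₀ x) := by
          intro x
          rw [hformula x, hnt, real_inner_smul_right, smul_smul]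
          show Fr P₀ x - (2 * (t * ⟪Fr P₀ x, e₃⟫_ℝ) * t) • e₃ = Fr P₀ x - (2 * ⟪Fr P₀ x, e₃⟫_ℝ) • e₃
          congr 2
          linear_combination 2 * ⟪Fr P₀ x, e₃⟫_ℝ * htt
        have himgP₀ : Fr P₀ '' Λ₀ = H '' (Fr (c₀ :: P₀) '' Λ₀) := by
          rw [Set.image_image]
          exact Set.image_congr fun x _ => by rw [hH', hHH]
        -- `e₃` is a menu normal of `Fr P₀`, hence of `Fr (c₀ :: P₀)`
        have hmenuP₀ : ∀ w ∈ fccSlots, ⟪Fr P₀ w, e₃⟫_ℝ = 0 ∨ ⟪Fr P₀ w, e₃⟫_ℝ = Real.sqrt (2 / 3) ∨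
            ⟪Fr P₀ w, e₃⟫_ℝ = -Real.sqrt (2 / 3) := by
          intro w hw
          have ht1 : t = 1 ∨ t = -1 := by
            have : (t - 1) * (t + 1) = 0 := by nlinarith
            rcases mul_eq_zero.1 this with h | h
            · left; linarith
            · right; linarith
          have e1 : ⟪Fr P₀ w, e₃⟫_ℝ = t * ⟪Fr P₀ w, Fr P₀ (diagVec c₀)⟫_ℝ := by
            rw [hnt, real_inner_smul_right, ← mul_assoc, htt, one_mul]
          rcases menuFr P₀ c₀ w hw with h | h | h <;> rw [e1, h] <;> rcases ht1 with h1 | h1 <;> rw [h1]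
          · left; ring
          · left; ring
          · right; left; ring
          · right; right; ring
          · right; right; ring
          · right; left; ring
        have hmenuT : ∀ w ∈ fccSlots, ⟪Fr (c₀ :: P₀) w, e₃⟫_ℝ = 0 ∨ ⟪Fr (c₀ :: P₀) w, e₃⟫_ℝ = Real.sqrt (2 / 3) ∨
            ⟪Fr (c₀ :: P₀) w, e₃⟫_ℝ = -Real.sqrt (2 / 3) := by
          intro w hw
          rw [hH', hHe]
          rcases hmenuP₀ w hw with h | h | h <;> rw [h]
          · left; ring
          · right; right; rfl
          · right; left; ring
        rcases typeAB _ hterm₀ with hA | ⟨hm, hB⟩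
        · exact hP₀ (Or.inr ⟨menu_of_image_eq (Fr (c₀ :: P₀)) A₂ hA hmenuT, by rw [himgP₀, hA]⟩)
        · exact hP₀ (Or.inl (by rw [himgP₀, hB, hHimg]))
    · intro F hF n hn hmenu F' hF'
      obtain ⟨P, hP, hFP, hsuf⟩ := hF
      rw [hFP] at hmenu hF'
      obtain ⟨c, hnc, hout, hin⟩ := stepA P hP hsuf n hn hmenu F' hF'
      refine ⟨hout, fun hmem => ?_⟩
      obtain ⟨hred, hF'c⟩ := hin hmem
      have hterm : Fr (c :: P) ∈ 𝓣 := by rw [← hF'c]; exact hmem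
      have hEq := unique c P c₀ P₀ hred hsuf hterm hred₀ hsuf₀ hterm₀
      obtain ⟨rfl, rfl⟩ := List.cons.inj hEq
      exact hnc
  · refine ⟨𝓐, EuclideanSpace.single (0 : Fin 3) (1 : ℝ), by rw [PiLp.norm_single, norm_one], ?_, hA₁𝓐, h𝓐𝓣, ?_⟩
    · rw [he₃, EuclideanSpace.inner_single_left]; simp
    · intro F hF n hn hmenu F' hF'
      obtain ⟨P, hP, hFP, hsuf⟩ := hF
      rw [hFP] at hmenu hF'
      obtain ⟨c, -, hout, hin⟩ := stepA P hP hsuf n hn hmenu F' hF'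
      refine ⟨hout, fun hmem => ?_⟩
      obtain ⟨hred, hF'c⟩ := hin hmem
      exact absurd ⟨c, P, hred, hsuf, by rw [← hF'c]; exact hmem⟩ hex

end Summit.Ventures.Crystal3D.Theorems

end
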